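import Summits.AtomisticToContinuum.Crystallization.Theorems.MinimisingLawsHaveAtoms.Negative.DiffuseFamilyLaws
import Mathlib.Analysis.SpecialFunctions.Exp

/-!
# Negative knowledge for crux `MinimisingLawsHaveAtoms` (stmt-AtomisticToContinuum-15776), III:
# the random-spacing chain — the minimising hypothesis is load-bearing

Standing crux disprover `cdisprove-stmt-AtomisticToContinuum-15776`,
`--supports stmt-AtomisticToContinuum-15776`; instance of the machine of Part II
(`DiffuseFamilyLaws.lean`), definition-free.

THE RANDOM-SPACING CHAIN `t ↦ ℤ · s(t) e₀`, `s(t) = 1 + eᵗ/3`, `e₀ = EuclideanSpace.single 0 1`: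
rank-one lattices (`mem_zmultiples_smul_iff`), `s`-separated with the gap attained
(`gap_zmultiples`), continuous in the local rubber metric (`continuous_mk_zmultiples`), separated by
the SET-VALUED isometry invariant "the attained hard cores of `X`" (`gapSet_image`), hence
`measurableEmbedding_chain`: `t ↦ count|ℤ s(t) e₀` is a measurable embedding of `ℝ` into `Measure ℝ³`.
The CHAIN LAW (push-forward of Lebesgue measure on `[0,1]`) is then a probability law, a.s.
`1`-hard-core, POINT-STATIONARY (each chain is an additive subgroup: pointwise Mecke identity) and
charges NO rooted isometry class.  Hence

`minimisingLawsHaveAtoms_false_without_minimising` — WITHOUT the energy hypothesis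
`∫ rootEnergy dP ≤ e*` the crux `IsometryAtoms.MinimisingLawsHaveAtoms` is FALSE.

Moral for the prover: the frame (hard core, Mecke identity, probability) carries isometry-DIFFUSE
laws; only the energy — in fact only its exact value `e*` (Part I) — can force an atom.  (Part IV,
`RandomSpacingChainEnergy.lean`: the chain law has `E[h] < 0`, so rescaling it shows the
normalisation `P(univ) = 1` is load-bearing too.)  All `[folklore]`.
-/

noncomputable section

namespace Summit.AtomisticToContinuum.Crystallization.Theorems.MinimisingLawsHaveAtoms.Negative.RandomSpacingChain

open MeasureTheory Set Filter Metric Function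
open scoped ENNReal Topology
open Literature.MathematicalPhysics.StatisticalMechanics Literature.Probability.Process
open Literature.Probability.Process.LocalConfig
open Summit.AtomisticToContinuum.Crystallization.Theorems.MinimisingLawsHaveAtoms.Negative.DiffuseFamilyLaws

/-! ## §1 The chains `ℤ · s e₀` -/

/-- Points of the chain `ℤ · s e₀` are the real multiples `k • (s e₀)`, `k ∈ ℤ`. [folklore] -/
theorem mem_zmultiples_smul_iff {s : ℝ} {x : EuclideanSpace ℝ (Fin 3)} :
    x ∈ (AddSubgroup.zmultiples (s • EuclideanSpace.single (0 : Fin 3) (1 : ℝ)) :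
      Set (EuclideanSpace ℝ (Fin 3))) ↔
      ∃ k : ℤ, x = (k : ℝ) • (s • EuclideanSpace.single (0 : Fin 3) (1 : ℝ)) := by
  rw [SetLike.mem_coe, AddSubgroup.mem_zmultiples_iff]
  constructor
  · rintro ⟨k, rfl⟩
    exact ⟨k, (Int.cast_smul_eq_zsmul ℝ k _).symm⟩
  · rintro ⟨k, rfl⟩
    exact ⟨k, (Int.cast_smul_eq_zsmul ℝ k _).symm⟩

/-- Chains are countable. [folklore] -/
theorem countable_zmultiples (w : EuclideanSpace ℝ (Fin 3)) :
    ((AddSubgroup.zmultiples w : AddSubgroup (EuclideanSpace ℝ (Fin 3))) :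
      Set (EuclideanSpace ℝ (Fin 3))).Countable := by
  have : ((AddSubgroup.zmultiples w : AddSubgroup (EuclideanSpace ℝ (Fin 3))) :
      Set (EuclideanSpace ℝ (Fin 3))) ⊆ Set.range fun k : ℤ => k • w := fun x hx => by
    obtain ⟨k, rfl⟩ := AddSubgroup.mem_zmultiples_iff.1 hx
    exact ⟨k, rfl⟩
  exact (Set.countable_range _).mono this

/-- Norm of a chain point: `‖k • s e₀‖ = |k| s` (`s ≥ 0`). [folklore] -/
theorem norm_chainPt {s : ℝ} (hs : 0 ≤ s) (k : ℤ) :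
    ‖(k : ℝ) • (s • EuclideanSpace.single (0 : Fin 3) (1 : ℝ))‖ = |(k : ℝ)| * s := by
  have h1 : ‖(EuclideanSpace.single (0 : Fin 3) (1 : ℝ))‖ = 1 := by simp
  rw [norm_smul, norm_smul, h1, mul_one, Real.norm_eq_abs, Real.norm_of_nonneg hs]

/-- Two chain points with the same index in chains of spacings `s, s'` are `|k| |s − s'|` apart.
[folklore] -/
theorem dist_chainPt_chainPt (s s' : ℝ) (k : ℤ) :
    dist ((k : ℝ) • (s • EuclideanSpace.single (0 : Fin 3) (1 : ℝ)))
      ((k : ℝ) • (s' • EuclideanSpace.single (0 : Fin 3) (1 : ℝ))) = |(k : ℝ)| * |s - s'| := by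
  have h1 : ‖(EuclideanSpace.single (0 : Fin 3) (1 : ℝ))‖ = 1 := by simp
  rw [dist_eq_norm, ← smul_sub, ← sub_smul, norm_smul, norm_smul, h1, mul_one,
    Real.norm_eq_abs, Real.norm_eq_abs]

/-- **The chain `ℤ · s e₀` is `s`-separated** (`s > 0`). [folklore] -/
theorem zmultiples_separated {s : ℝ} (hs : 0 < s) :
    ∀ x ∈ (AddSubgroup.zmultiples (s • EuclideanSpace.single (0 : Fin 3) (1 : ℝ)) :
      Set (EuclideanSpace ℝ (Fin 3))),
    ∀ y ∈ (AddSubgroup.zmultiples (s • EuclideanSpace.single (0 : Fin 3) (1 : ℝ)) :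
      Set (EuclideanSpace ℝ (Fin 3))), x ≠ y → s ≤ dist x y := by
  intro x hx y hy hxy
  obtain ⟨k, rfl⟩ := mem_zmultiples_smul_iff.1 hx
  obtain ⟨l, rfl⟩ := mem_zmultiples_smul_iff.1 hy
  have hkl : k ≠ l := fun h => hxy (by rw [h])
  rw [dist_eq_norm, ← sub_smul, ← Int.cast_sub, norm_chainPt hs.le]
  have h1 : (1 : ℝ) ≤ |((k - l : ℤ) : ℝ)| := by
    rw [← Int.cast_abs]
    exact_mod_cast Int.one_le_abs (sub_ne_zero.2 hkl)
  nlinarith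

/-- The chain with `s ≥ 1` is a rooted `1`-hard-core configuration (the proof obligation of
`RootedHardCoreConfig`). [folklore] -/
theorem zmultiples_rooted_hardCore {s : ℝ} (hs : 1 ≤ s) :
    (0 : EuclideanSpace ℝ (Fin 3)) ∈ (LocalConfig.mk (AddSubgroup.zmultiples
        (s • EuclideanSpace.single (0 : Fin 3) (1 : ℝ)) : Set (EuclideanSpace ℝ (Fin 3))) :
          LocalConfig (EuclideanSpace ℝ (Fin 3))) ∧
      ∀ x ∈ (LocalConfig.mk (AddSubgroup.zmultiples
        (s • EuclideanSpace.single (0 : Fin 3) (1 : ℝ)) : Set (EuclideanSpace ℝ (Fin 3))) :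
          LocalConfig (EuclideanSpace ℝ (Fin 3))),
      ∀ y ∈ (LocalConfig.mk (AddSubgroup.zmultiples
        (s • EuclideanSpace.single (0 : Fin 3) (1 : ℝ)) : Set (EuclideanSpace ℝ (Fin 3))) :
          LocalConfig (EuclideanSpace ℝ (Fin 3))), x ≠ y → (1 : ℝ) ≤ dist x y :=
  ⟨(AddSubgroup.zmultiples _).zero_mem, fun x hx y hy hxy =>
    hs.trans (zmultiples_separated (one_pos.trans_le hs) x hx y hy hxy)⟩

/-- **The gap is attained**: `ℤ · s e₀` is `s`-separated and `0`, `s e₀` are at distance exactly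
`s`; consequently the set of "attained hard cores" of the chain is `{s}`. [folklore] -/
theorem gapSet_zmultiples {s : ℝ} (hs : 0 < s) :
    {a : ℝ | (∀ x ∈ (AddSubgroup.zmultiples (s • EuclideanSpace.single (0 : Fin 3) (1 : ℝ)) :
        Set (EuclideanSpace ℝ (Fin 3))),
      ∀ y ∈ (AddSubgroup.zmultiples (s • EuclideanSpace.single (0 : Fin 3) (1 : ℝ)) :
        Set (EuclideanSpace ℝ (Fin 3))), x ≠ y → a ≤ dist x y) ∧
      ∃ x ∈ (AddSubgroup.zmultiples (s • EuclideanSpace.single (0 : Fin 3) (1 : ℝ)) :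
        Set (EuclideanSpace ℝ (Fin 3))),
      ∃ y ∈ (AddSubgroup.zmultiples (s • EuclideanSpace.single (0 : Fin 3) (1 : ℝ)) :
        Set (EuclideanSpace ℝ (Fin 3))), x ≠ y ∧ dist x y = a} = {s} := by
  have hgen : s • EuclideanSpace.single (0 : Fin 3) (1 : ℝ) ∈
      (AddSubgroup.zmultiples (s • EuclideanSpace.single (0 : Fin 3) (1 : ℝ)) :
        Set (EuclideanSpace ℝ (Fin 3))) := mem_zmultiples_smul_iff.2 ⟨1, by simp⟩
  have h1 : ‖(EuclideanSpace.single (0 : Fin 3) (1 : ℝ))‖ = 1 := by simp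
  have hd : dist (0 : EuclideanSpace ℝ (Fin 3)) (s • EuclideanSpace.single (0 : Fin 3) (1 : ℝ)) = s := by
    rw [dist_zero_left, norm_smul, h1, mul_one, Real.norm_of_nonneg hs.le]
  have hne : (0 : EuclideanSpace ℝ (Fin 3)) ≠ s • EuclideanSpace.single (0 : Fin 3) (1 : ℝ) := by
    intro h
    have := hd
    rw [← h, dist_self] at this
    linarith
  ext a
  simp only [mem_setOf_eq, mem_singleton_iff]
  constructor
  · rintro ⟨hsep, x, hx, y, hy, hxy, rfl⟩
    exact le_antisymm (hd ▸ hsep 0 (AddSubgroup.zmultiples _).zero_mem _ hgen hne)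
      (zmultiples_separated hs x hx y hy hxy)
  · rintro rfl
    exact ⟨zmultiples_separated hs, 0, (AddSubgroup.zmultiples _).zero_mem, _, hgen, hne, hd⟩

/-- **The set of attained hard cores is an isometry invariant** of point sets. [folklore] -/
theorem gapSet_image {φ : EuclideanSpace ℝ (Fin 3) → EuclideanSpace ℝ (Fin 3)} (hφ : Isometry φ)
    (X : Set (EuclideanSpace ℝ (Fin 3))) :
    {a : ℝ | (∀ x ∈ φ '' X, ∀ y ∈ φ '' X, x ≠ y → a ≤ dist x y) ∧
      ∃ x ∈ φ '' X, ∃ y ∈ φ '' X, x ≠ y ∧ dist x y = a} =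
    {a : ℝ | (∀ x ∈ X, ∀ y ∈ X, x ≠ y → a ≤ dist x y) ∧
      ∃ x ∈ X, ∃ y ∈ X, x ≠ y ∧ dist x y = a} := by
  ext a
  simp only [mem_setOf_eq]
  constructor
  · rintro ⟨hsep, _, ⟨x, hx, rfl⟩, _, ⟨y, hy, rfl⟩, hxy, hd⟩
    refine ⟨fun x' hx' y' hy' hne => ?_, x, hx, y, hy, fun e => hxy (by rw [e]), by rwa [hφ.dist_eq] at hd⟩
    have := hsep (φ x') (mem_image_of_mem φ hx') (φ y') (mem_image_of_mem φ hy')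
      (fun e => hne (hφ.injective e))
    rwa [hφ.dist_eq] at this
  · rintro ⟨hsep, x, hx, y, hy, hxy, hd⟩
    refine ⟨?_, φ x, mem_image_of_mem φ hx, φ y, mem_image_of_mem φ hy,
      fun e => hxy (hφ.injective e), by rwa [hφ.dist_eq]⟩
    rintro _ ⟨x', hx', rfl⟩ _ ⟨y', hy', rfl⟩ hne
    rw [hφ.dist_eq]
    exact hsep x' hx' y' hy' fun e => hne (by rw [e])

/-! ## §2 Continuity of `s ↦ ℤ · s e₀` in the local rubber metric (`s ≥ 1`) -/

/-- Chains of spacings `s, s' ≥ 1` with `R |s − s'| ≤ ε` are `(R, ε)`-matched index by index.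
[folklore] -/
theorem locallyMatches_zmultiples {s s' R ε : ℝ} (hs : 1 ≤ s) (hs' : 1 ≤ s')
    (h : R * |s - s'| ≤ ε) :
    LocallyMatches R ε
      (AddSubgroup.zmultiples (s • EuclideanSpace.single (0 : Fin 3) (1 : ℝ)) :
        Set (EuclideanSpace ℝ (Fin 3)))
      (AddSubgroup.zmultiples (s' • EuclideanSpace.single (0 : Fin 3) (1 : ℝ)) :
        Set (EuclideanSpace ℝ (Fin 3))) := by
  have key : ∀ (k : ℤ) (u : ℝ), 1 ≤ u →
      ‖(k : ℝ) • (u • EuclideanSpace.single (0 : Fin 3) (1 : ℝ))‖ ≤ R →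
      |(k : ℝ)| * |s - s'| ≤ ε := by
    intro k u hu hR
    rw [norm_chainPt (zero_le_one.trans hu)] at hR
    have hk : |(k : ℝ)| ≤ R := by nlinarith [abs_nonneg (k : ℝ)]
    calc |(k : ℝ)| * |s - s'| ≤ R * |s - s'| :=
          mul_le_mul_of_nonneg_right hk (abs_nonneg _)
      _ ≤ ε := h
  refine ⟨fun p hp hpR => ?_, fun q hq hqR => ?_⟩
  · obtain ⟨k, rfl⟩ := mem_zmultiples_smul_iff.1 hp
    refine ⟨(k : ℝ) • (s • EuclideanSpace.single (0 : Fin 3) (1 : ℝ)),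
      mem_zmultiples_smul_iff.2 ⟨k, rfl⟩, ?_⟩
    rw [dist_chainPt_chainPt]
    exact key k s' hs' hpR
  · obtain ⟨k, rfl⟩ := mem_zmultiples_smul_iff.1 hq
    refine ⟨(k : ℝ) • (s' • EuclideanSpace.single (0 : Fin 3) (1 : ℝ)),
      mem_zmultiples_smul_iff.2 ⟨k, rfl⟩, ?_⟩
    rw [dist_chainPt_chainPt]
    exact key k s hs hqR

/-- **The chain family is continuous in the local rubber metric** along any continuous spacing
function `σ ≥ 1`. [folklore] -/
theorem continuous_mk_zmultiples {σ : ℝ → ℝ} (hσ : Continuous σ) (hσ1 : ∀ t, 1 ≤ σ t) :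
    Continuous fun t => (LocalConfig.mk (AddSubgroup.zmultiples
      (σ t • EuclideanSpace.single (0 : Fin 3) (1 : ℝ)) : Set (EuclideanSpace ℝ (Fin 3))) :
        LocalConfig (EuclideanSpace ℝ (Fin 3))) := by
  refine Metric.continuous_iff.2 fun t₀ ε hε => ?_
  set ε₁ : ℝ := min ε 1 with hε₁def
  have hε₁ : 0 < ε₁ := lt_min hε one_pos
  have hε₁ε : ε₁ ≤ ε := min_le_left _ _
  obtain ⟨η, hη, hηs⟩ := Metric.continuous_iff.1 hσ t₀ (ε₁ ^ 2 / 4) (by positivity)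
  refine ⟨η, hη, fun t ht => ?_⟩
  have hst : |σ t - σ t₀| < ε₁ ^ 2 / 4 := by
    have := hηs t ht
    rwa [Real.dist_eq] at this
  have hm := locallyMatches_zmultiples (R := (ε₁ / 2)⁻¹) (ε := ε₁ / 2) (hσ1 t) (hσ1 t₀)
    (by
      calc (ε₁ / 2)⁻¹ * |σ t - σ t₀| ≤ (ε₁ / 2)⁻¹ * (ε₁ ^ 2 / 4) :=
            mul_le_mul_of_nonneg_left hst.le (by positivity)
        _ = ε₁ / 2 := by field_simp; ring)
  have hd := dist_le_of_locallyMatches (by positivity : (0 : ℝ) < ε₁ / 2) hm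
  exact lt_of_le_of_lt hd (by linarith)

/-! ## §3 The random-spacing chain family is a measurable embedding -/

/-- The spacing `s(t) = 1 + eᵗ/3` exceeds `1`. [folklore] -/
theorem one_lt_spacing (t : ℝ) : 1 < 1 + Real.exp t / 3 := by
  have := Real.exp_pos t
  linarith

/-- **`t ↦ count|ℤ s(t) e₀` is a measurable embedding of `ℝ` into `Measure ℝ³`**: the family is
continuous into the compact metric space of rooted `1`-hard-core configurations and injective
(the attained-gap invariant recovers `s(t)`, and `s` is injective). [folklore] -/
theorem measurableEmbedding_chain :
    MeasurableEmbedding fun t : ℝ => (Measure.count : Measure (EuclideanSpace ℝ (Fin 3))).restrict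
      (AddSubgroup.zmultiples ((1 + Real.exp t / 3) • EuclideanSpace.single (0 : Fin 3) (1 : ℝ)) :
        Set (EuclideanSpace ℝ (Fin 3))) := by
  haveI : Fact ((0 : ℝ) < 1) := ⟨one_pos⟩
  set f : ℝ → RootedHardCoreConfig (EuclideanSpace ℝ (Fin 3)) 1 := fun t =>
    ⟨LocalConfig.mk (AddSubgroup.zmultiples
      ((1 + Real.exp t / 3) • EuclideanSpace.single (0 : Fin 3) (1 : ℝ)) :
        Set (EuclideanSpace ℝ (Fin 3))), zmultiples_rooted_hardCore (one_lt_spacing t).le⟩ with hf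
  have hcont : Continuous f :=
    (continuous_mk_zmultiples (σ := fun t => 1 + Real.exp t / 3)
      (continuous_const.add (Real.continuous_exp.div_const 3))
      fun t => (one_lt_spacing t).le).subtype_mk _
  have hinj : Injective f := by
    intro t₁ t₂ h
    have hset := congrArg
      (fun S : RootedHardCoreConfig (EuclideanSpace ℝ (Fin 3)) 1 =>
        ((S.1 : LocalConfig (EuclideanSpace ℝ (Fin 3))) : Set (EuclideanSpace ℝ (Fin 3)))) h
    simp only [hf, coe_mk] at hset
    have hg := congrArg (fun X : Set (EuclideanSpace ℝ (Fin 3)) =>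
      {a : ℝ | (∀ x ∈ X, ∀ y ∈ X, x ≠ y → a ≤ dist x y) ∧
        ∃ x ∈ X, ∃ y ∈ X, x ≠ y ∧ dist x y = a}) hset
    simp only [gapSet_zmultiples (one_pos.trans (one_lt_spacing t₁)),
      gapSet_zmultiples (one_pos.trans (one_lt_spacing t₂)), singleton_eq_singleton_iff] at hg
    exact Real.exp_injective (by linarith)
  exact measurableEmbedding_count_restrict_of_continuous f hcont hinj

/-! ## §4 The chain law: probability, hard-core, point-stationary, isometry-diffuse -/

/-- Lebesgue measure on `[0,1]` is a probability measure. [folklore] -/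
theorem isProbabilityMeasure_volume_Icc :
    IsProbabilityMeasure ((volume : Measure ℝ).restrict (Icc 0 1)) :=
  ⟨by rw [Measure.restrict_apply_univ, Real.volume_Icc]; simp⟩

/-- **The chain law is a probability law.** [folklore] -/
theorem isProbabilityMeasure_chainLaw :
    IsProbabilityMeasure (((volume : Measure ℝ).restrict (Icc 0 1)).map fun t : ℝ =>
      (Measure.count : Measure (EuclideanSpace ℝ (Fin 3))).restrict
        (AddSubgroup.zmultiples ((1 + Real.exp t / 3) • EuclideanSpace.single (0 : Fin 3) (1 : ℝ)) :
          Set (EuclideanSpace ℝ (Fin 3)))) := by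
  haveI := isProbabilityMeasure_volume_Icc
  exact Measure.isProbabilityMeasure_map measurableEmbedding_chain.measurable.aemeasurable

/-- **The chain law is a.s. `1`-hard-core.** [folklore] -/
theorem ae_isRootedHardCore_chainLaw :
    ∀ᵐ μ ∂(((volume : Measure ℝ).restrict (Icc 0 1)).map fun t : ℝ =>
      (Measure.count : Measure (EuclideanSpace ℝ (Fin 3))).restrict
        (AddSubgroup.zmultiples ((1 + Real.exp t / 3) • EuclideanSpace.single (0 : Fin 3) (1 : ℝ)) :
          Set (EuclideanSpace ℝ (Fin 3)))), IsRootedHardCore 1 μ :=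
  ae_isRootedHardCore_map_family measurableEmbedding_chain fun t =>
    ⟨_, (AddSubgroup.zmultiples _).zero_mem, fun x hx y hy hxy => (one_lt_spacing t).le.trans
      (zmultiples_separated (one_pos.trans (one_lt_spacing t)) x hx y hy hxy), rfl⟩

/-- **The chain law is point-stationary** (each chain is a countable additive subgroup, pointwise
Mecke identity). [folklore] -/
theorem isPointStationaryLaw_chainLaw :
    IsPointStationaryLaw (((volume : Measure ℝ).restrict (Icc 0 1)).map fun t : ℝ =>
      (Measure.count : Measure (EuclideanSpace ℝ (Fin 3))).restrict
        (AddSubgroup.zmultiples ((1 + Real.exp t / 3) • EuclideanSpace.single (0 : Fin 3) (1 : ℝ)) :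
          Set (EuclideanSpace ℝ (Fin 3)))) :=
  isPointStationaryLaw_map_family measurableEmbedding_chain fun _ g =>
    mecke_count_restrict_addSubgroup _ (countable_zmultiples _) g

/-- **The chain law charges NO rooted isometry class** (Lebesgue measure has no atoms; the
attained-gap invariant separates the chains). [folklore] -/
theorem chainLaw_rootedClass_eq_zero (Y : Set (EuclideanSpace ℝ (Fin 3))) :
    (((volume : Measure ℝ).restrict (Icc 0 1)).map fun t : ℝ =>
      (Measure.count : Measure (EuclideanSpace ℝ (Fin 3))).restrict
        (AddSubgroup.zmultiples ((1 + Real.exp t / 3) • EuclideanSpace.single (0 : Fin 3) (1 : ℝ)) :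
          Set (EuclideanSpace ℝ (Fin 3))))
      {μ : Measure (EuclideanSpace ℝ (Fin 3)) |
        ∃ A : EuclideanSpace ℝ (Fin 3) →ₗᵢ[ℝ] EuclideanSpace ℝ (Fin 3), ∃ q ∈ Y,
          μ = (Measure.count : Measure (EuclideanSpace ℝ (Fin 3))).restrict
            ((fun s => A (s - q)) '' Y)} = 0 := by
  refine map_family_rootedClass_eq_zero measurableEmbedding_chain
    (fun X : Set (EuclideanSpace ℝ (Fin 3)) =>
      {a : ℝ | (∀ x ∈ X, ∀ y ∈ X, x ≠ y → a ≤ dist x y) ∧ ∃ x ∈ X, ∃ y ∈ X, x ≠ y ∧ dist x y = a})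
    (fun φ hφ X => gapSet_image hφ X) ?_ Y
  intro t₁ t₂ h
  simp only [gapSet_zmultiples (one_pos.trans (one_lt_spacing t₁)),
    gapSet_zmultiples (one_pos.trans (one_lt_spacing t₂)), singleton_eq_singleton_iff] at h
  exact Real.exp_injective (by linarith)

/-- **The minimising hypothesis is load-bearing** (`MinimisingLawsHaveAtoms` WITHOUT
`∫ rootEnergy dP ≤ e*`, stated inline, is FALSE): the random-spacing chain law is a
point-stationary `1`-hard-core probability law charging no rooted isometry class. [folklore] -/
theorem minimisingLawsHaveAtoms_false_without_minimising :
    ¬ (∀ δ : ℝ, 0 < δ → ∀ P : Measure (Measure (EuclideanSpace ℝ (Fin 3))), IsProbabilityMeasure P →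
      (∀ᵐ μ ∂P, IsRootedHardCore δ μ) → IsPointStationaryLaw P →
      ∃ Y : Set (EuclideanSpace ℝ (Fin 3)), 0 < P {μ | ∃ A : EuclideanSpace ℝ (Fin 3) →ₗᵢ[ℝ]
        EuclideanSpace ℝ (Fin 3), ∃ q ∈ Y, μ = (Measure.count : Measure
          (EuclideanSpace ℝ (Fin 3))).restrict ((fun s => A (s - q)) '' Y)}) := by
  intro H
  obtain ⟨Y, hY⟩ := H 1 one_pos _ isProbabilityMeasure_chainLaw ae_isRootedHardCore_chainLaw
    isPointStationaryLaw_chainLaw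
  exact hY.ne' (chainLaw_rootedClass_eq_zero Y)

end Summit.AtomisticToContinuum.Crystallization.Theorems.MinimisingLawsHaveAtoms.Negative.RandomSpacingChain

end
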